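import Literature.MathematicalPhysics.QuantumFieldTheory.LatticeGaugeDobrushinPoincare
import HarnessLib

/-!
# Venture YMGap — track (a): the SHAPE of the strong-coupling mass-gap theorem with an explicit,
improvable threshold `β₀(N, d)`

HONEST FRAMING: this is a venture file (cell `pub-ymgap`, QuantumFields programme). It TYPES the
statement «unique DLR state and exponential clustering of 't Hooft-scaled `SU(N)` lattice
Yang–Mills for all `|β| < β₀`» with the threshold `β₀` as a free parameter, records that
Shen–Zhu–Zhu's theorem (CMP 400 (2023) 805, Thm. 1.2 + Cor. "mass gap"; the tree's named fact
`Literature.MathematicalPhysics.QuantumFieldTheory.shen_zhu_zhu`) is literally the instance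
`β₀ = 1/(16(d-1))`, and names the two CERTIFICATE shapes (a one-link Kantorovich–Rubinstein
contraction, a one-link Poincaré constant) from which the tree's PROVED Dobrushin pipeline
(`LatticeGaugeDobrushin`, `LatticeGaugeDobrushinPoincare`) delivers the statement at a given
coupling. It is the strong-coupling / high-temperature LATTICE regime only: no continuum limit,
no statement at large `β`, no Clay-problem claim. Nothing here is a new theorem about Yang–Mills;
the two bridge theorems `massGapAt_of_…` in the sibling file `StrongCouplingGapFromCertificate`
re-run the tree's proofs with the threshold left symbolic.

## Why the threshold is where it is (read off the tree's proof of the SZZ reduction)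

`shen_zhu_zhu_of_haarPoincare` obtains `|β| < 1/(16(d-1))` from three constants:
(1) the one-link Poincaré (Bakry–Émery) constant `K_B = N(1/2 - ‖B‖_op)` of the tilted Haar
measure `ν_B ∝ exp(N Re tr(g B)) dg` on `SU(N)` (`Ric = N/2`, `|Hess| ≤ N‖B‖_op`); (2) the staple
field has `‖B_ω‖_op ≤ 2(d-1)|β|` and moves by `≤ |β| n(x,y) ‖ω_y - η_y‖_F` when one neighbour link
`y` changes; (3) a link has `∑_y n(x,y) ≤ 6(d-1)` plaquette-neighbour incidences. Dobrushin's
row sum is then `6(d-1)|β| / (1/2 - 2(d-1)|β|) < 1 ⟺ |β| < 1/(16(d-1))`. Any CERTIFIED improvement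
of (1) — a one-link Poincaré constant `N·k(b)` with `k(b) > 1/2 - b` on `‖B‖_op ≤ b`, e.g. from a
curvature-dimension or spectral computation on the single group `SU(N)` — or a direct certified
one-link `W₁` contraction rate, feeds the SAME pipeline and yields the statement below for every
`β` with `6(d-1)|β| < k(2(d-1)|β|)` (`massGapAt_of_oneLinkPoincareBound`), i.e. an explicit
`β₀' > 1/(16(d-1))` as soon as `k(1/8) > 3/8`. That inequality on `k` is what the cell's
certificate search (track (a)) has to produce; this file only fixes the target's type.

## Contents

* `MassGapAt d N β` — at 't Hooft coupling `β` (bare coupling `N β` in the tree's `ymSpecification`):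
  (i) `HasUniqueGibbsMeasure`, (ii) SZZ-form exponential clustering of Lipschitz cylinder
  functions under every DLR state (verbatim the `β`-body of `shen_zhu_zhu`).
* `MassGapBelow d N β₀ := ∀ β, |β| < β₀ → MassGapAt d N β`;
  `shen_zhu_zhu_iff_massGapBelow : shen_zhu_zhu d N ↔ (2 ≤ d → 2 ≤ N → MassGapBelow d N (1/(16(d-1))))`
  (by `Iff.rfl` up to binder shuffling), monotonicity in `β₀`.
* `OneLinkKRCertificate d N β` — Dobrushin's condition in the Vasserstein form for the one-link
  conditional laws at this `β` (the `β`-body of the hypothesis of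
  `shen_zhu_zhu_of_dobrushinCondition`).
* `OneLinkPoincareBound N b k` — `Var_{ν_B}(ψ) ≤ M²/(N k)` for `‖B‖_op ≤ b` and `M`-Lipschitz `ψ`
  (Frobenius distance); SZZ/Bakry–Émery give it with `k = 1/2 - b` (`b < 1/2`).
* `ImprovedThreshold d N β₀' := 1/(16(d-1)) < β₀' ∧ MassGapBelow d N β₀'` — the cell's track-(a)
  target type; a witness `β₀'` is to be supplied by a certificate, nothing is asserted here.

## References

* H. Shen, R. Zhu, X. Zhu, CMP 400 (2023) 805–851, arXiv:2204.12737: Assumption 1.1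
  (`K_S = N/2 - 8N|β|(d-1) > 0`), Thm. 1.2, Rem. 1.3 and the Dobrushin remark after it, Lemma 4.1,
  Cor. 1.4 "mass gap".
* K. Osterwalder, E. Seiler, Ann. Phys. 110 (1978) 440, Thms. 3.5–3.7 (cluster-expansion regime;
  the tree's `osterwalder_seiler_strongCoupling_secondCountable`, proved, threshold existential).
* R. L. Dobrushin, Theory Probab. Appl. 15 (1970) 458; H. Föllmer, LNM 1362 (1988) Ch. I §2.
-/

noncomputable section

open MeasureTheory ProbabilityTheory
open scoped NNReal
open Literature.MathematicalPhysics
open Literature.Probability.LatticeModels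
open Literature.Probability.LatticeModels.DobrushinMetric
open Literature.MathematicalPhysics.QuantumLattice
open Literature.MathematicalPhysics.QuantumFieldTheory

namespace Summit.Ventures.YMGap

variable (d N : ℕ)

/-- **The strong-coupling mass-gap statement at one 't Hooft coupling `β`** for `SU(N)` lattice
Yang–Mills on `ℤ^d` (Wilson action at bare coupling `N β`, the tree's
`ymSpecification (fundamentalRep (Fin N)) (N * β)`): (i) the DLR state is unique
(`HasUniqueGibbsMeasure`), and (ii) for every DLR state `μ` there is a rate `c > 0` and, for every
bound `n` on the support sizes, a constant `c₁` with
`|Cov_μ(F₁, F₂)| ≤ c₁ e^{-c d(Λ₁, Λ₂)} (K₁ K₂ + ‖F₁‖_{L²(μ)} ‖F₂‖_{L²(μ)})` for Lipschitz cylinder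
functions `Fᵢ` with disjoint edge supports `Λᵢ`, `|Λᵢ| ≤ n`. This is VERBATIM the body of the
tree's named fact `shen_zhu_zhu d N` (Shen–Zhu–Zhu, CMP 400 (2023), Thm. 1.2 and Cor. 1.4) with
the quantifier over `β` and the hypothesis `|β| < 1/(16(d-1))` stripped off, so that other
thresholds can be stated (`MassGapBelow`, `shen_zhu_zhu_iff_massGapBelow`). -/
def MassGapAt (β : ℝ) : Prop :=
  HasUniqueGibbsMeasure (ymSpecification (d := d) (fundamentalRep (Fin N)) (N * β)) ∧
    ∀ μ ∈ ymGibbsMeasures (d := d) (fundamentalRep (Fin N)) (N * β),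
      ∃ c : ℝ, 0 < c ∧ ∀ n : ℕ, ∃ c₁ : ℝ,
        ∀ (F₁ F₂ : LGConfig d (Matrix.specialUnitaryGroup (Fin N) ℂ) → ℝ)
          (Λ₁ Λ₂ : Finset (QuantumLattice.ZdEdge d)) (K₁ K₂ : ℝ≥0),
          Λ₁.card ≤ n → Λ₂.card ≤ n → Disjoint Λ₁ Λ₂ →
          IsLipschitzCylinder (fundamentalRep (Fin N)) F₁ Λ₁ K₁ →
          IsLipschitzCylinder (fundamentalRep (Fin N)) F₂ Λ₂ K₂ →
            |cov[F₁, F₂; μ]| ≤ c₁ * Real.exp (-c * setDistEdges Λ₁ Λ₂) *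
              ((K₁ : ℝ) * K₂ + Real.sqrt (∫ U, F₁ U ^ 2 ∂μ) * Real.sqrt (∫ U, F₂ U ^ 2 ∂μ))

/-- **Mass gap below a threshold**: `MassGapAt d N β` for every 't Hooft coupling `|β| < β₀`.
The cell's track-(a) theorem has this type with an explicit `β₀ = β₀'(N, d)`. -/
def MassGapBelow (β₀ : ℝ) : Prop :=
  ∀ β : ℝ, |β| < β₀ → MassGapAt d N β

/-- `MassGapBelow` is antitone in the threshold: a larger certified window contains every smaller
one. -/
theorem massGapBelow_mono {d N : ℕ} {β₀ β₁ : ℝ} (h : β₀ ≤ β₁) (h₁ : MassGapBelow d N β₁) :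
    MassGapBelow d N β₀ :=
  fun β hβ => h₁ β (hβ.trans_le h)

/-- **Shen–Zhu–Zhu is the instance `β₀ = 1/(16(d-1))`.** The tree's named fact `shen_zhu_zhu d N`
(CMP 400 (2023), Assumption 1.1, Thm. 1.2, Cor. 1.4) is, definitionally up to the order of the
hypotheses, `MassGapBelow d N (1/(16(d-1)))` under `2 ≤ d`, `2 ≤ N`. -/
theorem shen_zhu_zhu_iff_massGapBelow {d N : ℕ} :
    shen_zhu_zhu d N ↔ (2 ≤ d → 2 ≤ N → MassGapBelow d N (1 / (16 * ((d : ℝ) - 1)))) := by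
  unfold shen_zhu_zhu MassGapBelow MassGapAt
  rfl

/-- Hence any proof of the tree's `shen_zhu_zhu d N` gives the mass gap below `1/(16(d-1))`, and
conversely. -/
theorem massGapBelow_szz_of_shen_zhu_zhu {d N : ℕ} (h : shen_zhu_zhu d N) (hd : 2 ≤ d)
    (hN : 2 ≤ N) : MassGapBelow d N (1 / (16 * ((d : ℝ) - 1))) :=
  shen_zhu_zhu_iff_massGapBelow.1 h hd hN

/-- **Certificate shape 1 — Dobrushin's condition in the Vasserstein (Kantorovich–Rubinstein)
form for the one-link conditional laws at 't Hooft coupling `β`.** There are a bounded weight `r`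
on `SU(N)` (`0 ≤ r ≤ R`) dominating the matrix-entry metric up to `A`, influence coefficients
`C ≥ 0` with row sums `∑_{y ∈ linkPlaqNbr x} C x y ≤ c < 1`, such that the laws of the link
variable `U_x` under the `SU(N)` Wilson specification at bare coupling `N β`, for boundary
conditions differing only at one plaquette-neighbour link `y`, are `C x y · r(ω_y, η_y)`-close when
tested on bounded measurable `r`-Lipschitz functions. VERBATIM the `β`-body of the hypothesis of
the tree's `shen_zhu_zhu_of_dobrushinCondition` (Dobrushin 1970; Föllmer 1988 Ch. I §2; the
Dobrushin route named by Shen–Zhu–Zhu after Rem. 1.3). A certified instance at a given `β` is a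
WITNESS for `MassGapAt d N β` (`massGapAt_of_oneLinkKRCertificate`, sibling file). -/
def OneLinkKRCertificate (β : ℝ) : Prop :=
  ∃ (r : Matrix.specialUnitaryGroup (Fin N) ℂ → Matrix.specialUnitaryGroup (Fin N) ℂ → ℝ)
    (R A c : ℝ) (C : QuantumLattice.ZdEdge d → QuantumLattice.ZdEdge d → ℝ),
    (∀ a b, 0 ≤ r a b) ∧ (∀ a b, r a b ≤ R) ∧ 0 ≤ A ∧
    (∀ a b, dist (suEntries a) (suEntries b) ≤ A * r a b) ∧
    (∀ x y, 0 ≤ C x y) ∧ c < 1 ∧ (∀ x, ∑ y ∈ linkPlaqNbr x, C x y ≤ c) ∧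
    ∀ (x : QuantumLattice.ZdEdge d), ∀ y ∈ linkPlaqNbr x,
      ∀ (ω η : LGConfig d (Matrix.specialUnitaryGroup (Fin N) ℂ)),
      (∀ z, z ≠ y → ω z = η z) →
      ∀ (φ : Matrix.specialUnitaryGroup (Fin N) ℂ → ℝ) (L : ℝ), Measurable φ →
        (∃ M, ∀ s, |φ s| ≤ M) → 0 ≤ L → (∀ a b, |φ a - φ b| ≤ L * r a b) →
        |∫ s, φ s ∂(siteLaw (ymSpecification (fundamentalRep (Fin N)) (N * β)) x ω) -
            ∫ s, φ s ∂(siteLaw (ymSpecification (fundamentalRep (Fin N)) (N * β)) x η)| ≤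
          C x y * L * r (ω y) (η y)

variable {d} in
/-- **Certificate shape 2 — a one-link Poincaré constant.** `OneLinkPoincareBound N b k`: for every
source `B ∈ M_N(ℂ)` with `‖B‖_op ≤ b`, the Gibbs-tilted Haar probability measure
`ν_B(dg) ∝ exp(N Re tr(g B)) dg` on `SU(N)` satisfies `Var_{ν_B}(ψ) ≤ M² / (N k)` for every `ψ`
that is `M`-Lipschitz for the Frobenius distance. Shen–Zhu–Zhu's Bakry–Émery computation
(Assumption 1.1, Lemma 4.1, (4.4)–(4.6): `Ric = N/2`, `|Hess| ≤ N‖B‖_op`) gives it with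
`k = 1/2 - b` for `b < 1/2`; that is the hypothesis `hLP` of the tree's
`shen_zhu_zhu_of_haarPoincare` restricted to the ball `‖B‖_op ≤ b`. An improved, certified `k(b)`
is the second kind of WITNESS the cell searches for (`massGapAt_of_oneLinkPoincareBound`). -/
def OneLinkPoincareBound (b k : ℝ) : Prop :=
  ∀ B : Matrix (Fin N) (Fin N) ℂ, matrixOpNorm B ≤ b →
    ∀ (ψ : Matrix.specialUnitaryGroup (Fin N) ℂ → ℝ) (M : ℝ), 0 ≤ M →
      (∀ a c, |ψ a - ψ c| ≤ M * suFrobDist a c) →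
      Var[ψ; (haarProbability (Matrix.specialUnitaryGroup (Fin N) ℂ)).tilted
          fun g => (N : ℝ) * ((g : Matrix (Fin N) (Fin N) ℂ) * B).trace.re] ≤
        M ^ 2 / ((N : ℝ) * k)

variable {N} in
/-- A one-link Poincaré bound on a ball is inherited by smaller balls and weaker constants. -/
theorem OneLinkPoincareBound.mono {b b' k k' : ℝ} (h : OneLinkPoincareBound N b k) (hb : b' ≤ b)
    (hk : k' ≤ k) (hk' : 0 < k') (hN : 0 < N) : OneLinkPoincareBound N b' k' := by
  intro B hB ψ M hM hψ
  refine (h B (hB.trans hb) ψ M hM hψ).trans ?_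
  have hN' : (0 : ℝ) < N := by exact_mod_cast hN
  exact div_le_div_of_nonneg_left (sq_nonneg M) (mul_pos hN' hk')
    (mul_le_mul_of_nonneg_left hk hN'.le)

/-- **The cell's track-(a) TARGET TYPE — an improved explicit threshold.**
`ImprovedThreshold d N β₀'` says that `β₀'` is STRICTLY larger than Shen–Zhu–Zhu's
`1/(16(d-1))` and the mass gap (`MassGapAt`) holds for every 't Hooft coupling `|β| < β₀'`.
Nothing is asserted: a proof for a specific numeral `β₀'` is to come from a certified one-link
witness through `massGapBelow_of_poincareProfile` (sibling file). -/
def ImprovedThreshold (β₀' : ℝ) : Prop :=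
  1 / (16 * ((d : ℝ) - 1)) < β₀' ∧ MassGapBelow d N β₀'

/-- An improved threshold contains Shen–Zhu–Zhu's window. -/
theorem ImprovedThreshold.massGapBelow_szz {d N : ℕ} {β₀' : ℝ} (h : ImprovedThreshold d N β₀') :
    MassGapBelow d N (1 / (16 * ((d : ℝ) - 1))) :=
  massGapBelow_mono h.1.le h.2

end Summit.Ventures.YMGap
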